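import Mathlib
import Summits.ResolutionOfSingularities.ResolutionOfSingularities.Theorems.RadicialJungCleanModelsCleanProp44TauTwoRegime
import HarnessLib

/-!
# Route `RadicialJung`, crux `CleanModels` (stmt-ResolutionOfSingularities-15917), line `Sketch` rev 35, stub 6 `stub_cleanProp44` (X44c):
# crossings of `Σ`-curves are `τ = 1` points

Seat decomp-res-hand-2 g15 (structural hand), companion of ✓ `…CleanProp44TauTwoRegime.lean` (`cleanProp44_of_two_le_stalkTau`: X44c in the
`τ ≥ 2` regime).  The kernel census of stub 6 (✓ `cleanProp44_of_tauOneResidual`) has as hypothesis (R1) clean Phase II of reach-tidy, which acts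
where two curves of `Σ = {ord J = μ}` CROSS.  Here: **a point common to two distinct curves of `Σ` (one of them regular) is a CLOSED threefold
point of the stratum with Hironaka `τ = 1`** (`stalkTau_eq_one_of_mem_closure_of_mem_closure`) — by ✓ `eq_of_two_le_stalkTau_of_mem_closure`
(at most one curve of `Σ` through a `τ ≥ 2` point, [CoP1] Lemma 4.3 (2)) and `1 ≤ τ` on the stratum (✓ `one_le_stalkTau`); the point is closed of
coheight `3` because it is a proper specialisation of a point of coheight `2` in a scheme of dimension `≤ 3`.  So (R1), like (R2) and (R3), lives
entirely at `τ = 1`.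

Honest framing: OURS; nothing here proves (R1), X44c, any case of `CleanModels`, or resolution of singularities in characteristic `p`.
[cite: CossartPiltant2008, Lemma 4.3 (2), Prop. 4.4 (proof, p. 10)]
-/

noncomputable section

set_option linter.dupNamespace false -- mandated namespace of this single-conjunct summit

open CategoryTheory AlgebraicGeometry TopologicalSpace IsLocalRing
open Literature.AlgebraicGeometry.Resolution
open Scheme.IdealSheafData
open Summit.ResolutionOfSingularities.ResolutionOfSingularities.Theorems.CP2008Prop44

namespace Summit.ResolutionOfSingularities.ResolutionOfSingularities.Theorems.RadicialJung.CleanModels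

/-- Two points of coheight `2` one of which specialises to the other are equal. [folklore] -/
private theorem eq_of_specializes_of_coheight_eq_two' {X : Scheme.{0}} {ζ₁ ζ₂ : X} (h : ζ₁ ⤳ ζ₂)
    (h₁ : Order.coheight ζ₁ = 2) (h₂ : Order.coheight ζ₂ = 2) : ζ₁ = ζ₂ := by
  by_contra hne
  have hlt : ζ₂ < ζ₁ := ⟨h, fun h' => hne (h.antisymm h').eq⟩
  have h3 := Order.coheight_add_one_le hlt
  rw [h₁, h₂] at h3
  exact absurd h3 (by decide)

/-- **Crossing points of `Σ`-curves are closed threefold points with `τ = 1`** (the prose of memo `Sketch-memo-hand2-g11` §0 (R1), now in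
the kernel).  `X` integral Noetherian regular quasi-excellent of dimension `≤ 3`, `(J, μ)` with `μ ≥ 1`, `ord ≤ μ`, `V(J)` of codimension `≥ 2`;
`ζ₁ ≠ ζ₂` points of `Σ` of coheight `2` with `cl{ζ₁}` regular, and `q ∈ cl{ζ₁} ∩ cl{ζ₂}`: then `q` is a CLOSED point of coheight `3` (embedding
dimension `3`), `ord_q J = μ`, and `τ_q(J, μ) = 1`.  So clean Phase II of reach-tidy (hypothesis (R1) `hphaseTwo` of ✓ `cleanProp44_of_tauOneResidual`)
only ever acts at `τ = 1` points. [cite: CossartPiltant2008, Lemma 4.3 (2), Prop. 4.4 (proof, p. 10)] -/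
theorem stalkTau_eq_one_of_mem_closure_of_mem_closure {X : Scheme.{0}} [IsIntegral X] [IsNoetherian X] (hX : Scheme.IsRegular X)
    (hqe : Scheme.IsQuasiExcellent X) (hX3 : topologicalKrullDim X ≤ 3) (J : X.IdealSheafData) {μ : ℕ} (hμ : 1 ≤ μ)
    (hle : ∀ z, idealOrder J z ≤ μ) (hcodim : ∀ z ∈ J.support, 1 < Order.coheight z)
    {ζ₁ ζ₂ : X} (hζ₁ : (μ : ℕ∞) ≤ idealOrder J ζ₁) (hcoh₁ : Order.coheight ζ₁ = 2)
    (hζ₂ : (μ : ℕ∞) ≤ idealOrder J ζ₂) (hcoh₂ : Order.coheight ζ₂ = 2) (hne : ζ₁ ≠ ζ₂)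
    (hreg : Scheme.IsRegular (vanishingIdeal (⟨closure {ζ₁}, isClosed_closure⟩ : Closeds X)).subscheme)
    {q : X} (hq₁ : q ∈ closure ({ζ₁} : Set X)) (hq₂ : q ∈ closure ({ζ₂} : Set X)) :
    IsClosed ({q} : Set X) ∧ Order.coheight q = 3 ∧ idealOrder J q = μ ∧
      ∀ hr : IsRegularLocalRing (X.presheaf.stalk q), @stalkTau X J q hr μ = 1 := by
  have hcoh3 : ∀ z : X, Order.coheight z ≤ 3 := (topologicalKrullDim_le_iff_forall_coheight_le X 3).mp hX3
  have hζ₁q : ζ₁ ⤳ q := specializes_iff_mem_closure.mpr hq₁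
  have hζ₂q : ζ₂ ⤳ q := specializes_iff_mem_closure.mpr hq₂
  -- `q ≠ ζ₁`: otherwise `ζ₂ ⤳ ζ₁`, two points of coheight `2`
  have hqζ₁ : ¬ q ⤳ ζ₁ := fun h => hne (eq_of_specializes_of_coheight_eq_two' (hζ₂q.trans h) hcoh₂ hcoh₁).symm
  have hζ₁supp : ζ₁ ∈ J.support := by
    rw [← one_le_idealOrder_iff]
    exact le_trans (by exact_mod_cast hμ) hζ₁
  obtain ⟨-, hcohq⟩ := coheight_eq_two_of_specializes hζ₁q hqζ₁ (hcodim _ hζ₁supp) (hcoh3 q)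
  have hqcl : IsClosed ({q} : Set X) := isClosed_singleton_of_coheight_eq_three hcoh3 hcohq
  haveI hrq : IsRegularLocalRing (X.presheaf.stalk q) := hX q
  have hordq : idealOrder J q = μ := le_antisymm (hle q) (hζ₁.trans (idealOrder_le_of_specializes hζ₁q J))
  refine ⟨hqcl, hcohq, hordq, fun hr => ?_⟩
  -- the curve `cl{ζ₁}` is cut out at `q` by two regular parameters
  obtain ⟨c, hcr, hcY⟩ := exists_isRsopPart_fin_two_of_specializes hreg rfl hζ₁q hqζ₁ (hcodim _ hζ₁supp) (hcoh3 q)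
  have h1 : 1 ≤ @stalkTau X J q hr μ := one_le_stalkTau J q hμ hordq
  -- `τ_q ≥ 2` would force `ζ₁ = ζ₂`
  have h2 : ¬ 2 ≤ @stalkTau X J q hr μ := fun hτ =>
    hne (eq_of_two_le_stalkTau_of_mem_closure hX hqe J hμ hle hcodim hζ₁ hcoh₁ hζ₂ hcoh₂ hreg hq₂ hcr hcY hτ)
  omega

end Summit.ResolutionOfSingularities.ResolutionOfSingularities.Theorems.RadicialJung.CleanModels

end
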